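import Literature.AlgebraicGeometry.Resolution.AffineDomainDimension
import Mathlib.RingTheory.RegularLocalRing.Defs
import Mathlib.RingTheory.Valuation.ValuationSubring
import Mathlib.RingTheory.LocalRing.ResidueField.Basic
import Mathlib.RingTheory.Ideal.GoingUp
import HarnessLib

/-!
# A finite extension of a regular local ring with a valuation basis is regular

Topic: `Literature/AlgebraicGeometry/Resolution`. Two pieces of commutative algebra / valuation
theory used in the tree's proof of S. D. Cutkosky, *Local uniformization of Abhyankar
valuations*, Michigan Math. J. 71 (2022) = arXiv:2003.06374, Thm. 1.3 (regular local
uniformization at Abhyankar places over an ARBITRARY ground field; named fact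
`Cutkosky2022_Thm13`, `LocalUniformizationAbhyankarPlaces.lean`). The tree does not follow the
printed proof (a Perron–Zariski reduction algorithm for pseudo-valuations on completions, §§3–5
of the source) but deduces the weak (affine-model) form of Thm. 1.3 from the generalized
stability theorem and the henselization, both proved in this topic; the present file holds the
two elementary lemmas of that argument which do not mention function fields:

* `valuation_sum_mul_eq_of_linearIndependent_residue` (with the corollaries `…_lt_one`,
  `…_le_one`, `eq_zero_of_sum_mul_eq_zero_of_linearIndependent_residue`,
  `linearIndependent_of_linearIndependent_residue`) — **valuation independence**: inside a valued
  field `(Ω, V)`, if `α₁, …, α_f ∈ V` have residues linearly independent over a subfield `Lr` of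
  the residue field containing the residues of a subfield `E ⊆ Ω`, then
  `v(∑ cᵢ αᵢ) = max v(cᵢ)` for coefficients `cᵢ ∈ E` (the computation at the heart of the
  fundamental inequality `e f ≤ n`, `FundamentalInequality.lean`).
* `comap_maximalIdeal_eq_map`, `isLocalRing_of_comap_maximalIdeal`,
  `maximalIdeal_eq_comap_maximalIdeal`, `isLocalHom_of_comap_maximalIdeal`,
  `isRegularLocalRing_of_comap_maximalIdeal` — **regularity of a residually free finite
  extension**: let `R → B` be injective, `R` a regular local ring, `B` spanned as an `R`-module
  by `α₁, …, αₙ`, and `g : B → V₀` a ring map to a local ring (the valuation ring) dominating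
  `R` (`g(r) ∈ 𝔪_{V₀} ↔ r ∈ 𝔪_R`) and such that `g(∑ cᵢ αᵢ) ∈ 𝔪_{V₀}` forces all `cᵢ ∈ 𝔪_R`.
  Then `B` is local with maximal ideal `𝔪_R B = g⁻¹(𝔪_{V₀})`, hence Noetherian of dimension
  `dim R` with a maximal ideal generated by `dim R` elements: `B` is a REGULAR local ring.
  (This is how regularity is obtained without smoothness when the residue field extension is
  inseparable.)

Everything here is [folklore]; no definitions, no named facts.

## References

* S. D. Cutkosky, *Local uniformization of Abhyankar valuations*, Michigan Math. J. 71 (2022)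
  = arXiv:2003.06374, Thm. 1.3. [Cutkosky2022]
* O. Zariski, P. Samuel, *Commutative Algebra* II, Ch. VI §11 (independence of a valuation
  basis).
-/

noncomputable section

namespace Literature.AlgebraicGeometry.Resolution

open IsLocalRing

universe u

/-! ## Valuation independence of lifts of residually independent elements -/

section Independence

variable {Ω : Type*} [Field Ω] (V : ValuationSubring Ω) (E : Subfield Ω)
  (Lr : Subfield (ResidueField V))
  (hL : ∀ c : Ω, c ∈ E → (hc : c ∈ V) → residue V ⟨c, hc⟩ ∈ Lr)

include hL in
/-- **Valuation independence.** If `α₁, …, α_f ∈ V` have residues linearly independent over a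
subfield `Lr` of the residue field containing the residues of the elements of `E ∩ V`, and
`c₁, …, c_f ∈ E` with `v(cᵢ) ≤ v(c_{i₀})`, `c_{i₀} ≠ 0`, then `v(∑ cᵢ αᵢ) = v(c_{i₀})`
(normalise by `c_{i₀}` and reduce: the residue of `∑ (cᵢ/c_{i₀}) αᵢ` has coefficient `1` at
`i₀`, so it is non-zero). [folklore] -/
theorem valuation_sum_mul_eq_of_linearIndependent_residue {f : ℕ} (α : Fin f → V)
    (hα : LinearIndependent Lr fun i => residue V (α i)) (c : Fin f → Ω) (hc : ∀ i, c i ∈ E)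
    (i₀ : Fin f) (hmax : ∀ i, V.valuation (c i) ≤ V.valuation (c i₀)) (hc0 : c i₀ ≠ 0) :
    V.valuation (∑ i, c i * (α i : Ω)) = V.valuation (c i₀) := by
  classical
  have hvc0 : V.valuation (c i₀) ≠ 0 := (Valuation.ne_zero_iff _).mpr hc0
  -- normalised coefficients lie in `V`
  have hgO : ∀ i, c i / c i₀ ∈ V := fun i => by
    refine (V.valuation_le_one_iff _).mp ?_
    rw [map_div₀]
    exact (div_le_one₀ (zero_lt_iff.mpr hvc0)).mpr (hmax i)
  -- the normalised sum is a unit of `V`: its residue is non-zero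
  let T : V := ∑ i, (⟨c i / c i₀, hgO i⟩ : V) * α i
  have hT : (T : Ω) = (∑ i, c i * (α i : Ω)) / c i₀ := by
    change ((∑ i, (⟨c i / c i₀, hgO i⟩ : V) * α i : V) : Ω) = _
    rw [AddSubmonoidClass.coe_finsetSum]
    change ∑ i, c i / c i₀ * (α i : Ω) = _
    rw [div_eq_mul_inv, Finset.sum_mul]
    exact Finset.sum_congr rfl fun i _ => by ring
  have hresT : residue V T ≠ 0 := by
    intro h0
    let l : Fin f → Lr := fun i => ⟨residue V ⟨c i / c i₀, hgO i⟩,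
      hL _ (div_mem (hc i) (hc i₀)) (hgO i)⟩
    have hrel : ∑ i, l i • residue V (α i) = 0 := by
      rw [← h0]
      change _ = residue V (∑ i, _)
      rw [map_sum]
      refine Finset.sum_congr rfl fun i _ => ?_
      rw [map_mul]
      rfl
    have hl0 := (Fintype.linearIndependent_iff.mp hα) l hrel i₀
    have hl1 : l i₀ = 1 := Subtype.ext (by
      change residue V ⟨c i₀ / c i₀, _⟩ = 1
      have h1 : (⟨c i₀ / c i₀, hgO i₀⟩ : V) = 1 := Subtype.ext (div_self hc0)
      rw [h1, map_one])
    rw [hl1] at hl0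
    exact one_ne_zero hl0
  have hvT : V.valuation (T : Ω) = 1 := by
    have h1 : T ∉ IsLocalRing.maximalIdeal V := fun hm => hresT ((residue_eq_zero_iff _).mpr hm)
    by_contra hne1
    exact h1 ((ValuationSubring.valuation_lt_one_iff V T).mpr
      (lt_of_le_of_ne (V.valuation_le_one T) hne1))
  rw [hT, map_div₀, div_eq_one_iff_eq hvc0] at hvT
  exact hvT

include hL in
/-- **Valuation independence, `max` form**: `v(∑ cᵢ αᵢ) ≥ v(c_j)` for every `j` (`cᵢ ∈ E`).
[folklore] -/
theorem valuation_le_valuation_sum_mul_of_linearIndependent_residue {f : ℕ} (α : Fin f → V)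
    (hα : LinearIndependent Lr fun i => residue V (α i)) (c : Fin f → Ω) (hc : ∀ i, c i ∈ E)
    (j : Fin f) : V.valuation (c j) ≤ V.valuation (∑ i, c i * (α i : Ω)) := by
  classical
  obtain ⟨i₀, -, hmax⟩ :=
    Finset.univ.exists_max_image (fun i => V.valuation (c i)) ⟨j, Finset.mem_univ _⟩
  by_cases hc0 : c i₀ = 0
  · have hcj : c j = 0 := by
      have h := hmax j (Finset.mem_univ _)
      rw [hc0, map_zero, le_zero_iff, map_eq_zero] at h
      exact h
    rw [hcj, map_zero]
    exact zero_le
  rw [valuation_sum_mul_eq_of_linearIndependent_residue V E Lr hL α hα c hc i₀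
    (fun i => hmax i (Finset.mem_univ _)) hc0]
  exact hmax j (Finset.mem_univ _)

include hL in
/-- If `v(∑ cᵢ αᵢ) < 1` then every `v(cᵢ) < 1`. [folklore] -/
theorem valuation_lt_one_of_sum_mul_lt_one_of_linearIndependent_residue {f : ℕ} (α : Fin f → V)
    (hα : LinearIndependent Lr fun i => residue V (α i)) (c : Fin f → Ω) (hc : ∀ i, c i ∈ E)
    (hlt : V.valuation (∑ i, c i * (α i : Ω)) < 1) (j : Fin f) : V.valuation (c j) < 1 :=
  (valuation_le_valuation_sum_mul_of_linearIndependent_residue V E Lr hL α hα c hc j).trans_lt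
    hlt

include hL in
/-- If `v(∑ cᵢ αᵢ) ≤ 1` then every `v(cᵢ) ≤ 1`, i.e. `cᵢ ∈ V`. [folklore] -/
theorem mem_of_sum_mul_mem_of_linearIndependent_residue {f : ℕ} (α : Fin f → V)
    (hα : LinearIndependent Lr fun i => residue V (α i)) (c : Fin f → Ω) (hc : ∀ i, c i ∈ E)
    (hle : (∑ i, c i * (α i : Ω)) ∈ V) (j : Fin f) : c j ∈ V :=
  (V.valuation_le_one_iff _).mp
    ((valuation_le_valuation_sum_mul_of_linearIndependent_residue V E Lr hL α hα c hc j).trans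
      ((V.valuation_le_one_iff _).mpr hle))

include hL in
/-- If `∑ cᵢ αᵢ = 0` then every `cᵢ = 0`. [folklore] -/
theorem eq_zero_of_sum_mul_eq_zero_of_linearIndependent_residue {f : ℕ} (α : Fin f → V)
    (hα : LinearIndependent Lr fun i => residue V (α i)) (c : Fin f → Ω) (hc : ∀ i, c i ∈ E)
    (h0 : (∑ i, c i * (α i : Ω)) = 0) (j : Fin f) : c j = 0 := by
  have h := valuation_le_valuation_sum_mul_of_linearIndependent_residue V E Lr hL α hα c hc j
  rw [h0, map_zero, le_zero_iff, map_eq_zero] at h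
  exact h

include hL in
/-- **Lifts of residually independent elements are linearly independent over `E`.**
[folklore] -/
theorem linearIndependent_of_linearIndependent_residue {f : ℕ} (α : Fin f → V)
    (hα : LinearIndependent Lr fun i => residue V (α i)) :
    LinearIndependent E fun i => (α i : Ω) := by
  rw [Fintype.linearIndependent_iff]
  intro g hsum j
  have h := eq_zero_of_sum_mul_eq_zero_of_linearIndependent_residue V E Lr hL α hα
    (fun i => (g i : Ω)) (fun i => (g i).2) (by
      rw [← hsum]
      exact Finset.sum_congr rfl fun i _ => rfl) j
  exact_mod_cast h

end Independence

/-! ## Regularity of a residually free finite extension of a regular local ring -/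

section Regular

variable {R B V₀ : Type*} [CommRing R] [CommRing B] [Algebra R B] [CommRing V₀] [IsLocalRing V₀]
  (g : B →+* V₀)

variable [IsLocalRing R]
  (hdom : ∀ r : R, g (algebraMap R B r) ∈ maximalIdeal V₀ ↔ r ∈ maximalIdeal R)
  {n : ℕ} (α : Fin n → B) (hspan : Submodule.span R (Set.range α) = ⊤)
  (hind : ∀ c : Fin n → R, g (∑ i, algebraMap R B (c i) * α i) ∈ maximalIdeal V₀ →
    ∀ i, c i ∈ maximalIdeal R)

include hdom hspan hind in
/-- **The pull-back of `𝔪_{V₀}` is `𝔪_R B`.** For `g : B → V₀` into a local ring (in practice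
the inclusion of a subring of a valued field into the valuation ring), `B = ∑ R αᵢ`, `g`
dominating `R` and "valuation independent" on the `αᵢ` (`g(∑ cᵢ αᵢ) ∈ 𝔪_{V₀}` forces all
`cᵢ ∈ 𝔪_R`): `g⁻¹(𝔪_{V₀}) = 𝔪_R B`. [folklore] -/
theorem comap_maximalIdeal_eq_map :
    (maximalIdeal V₀).comap g = (maximalIdeal R).map (algebraMap R B) := by
  classical
  apply le_antisymm
  · intro b hb
    have hbspan : b ∈ Submodule.span R (Set.range α) := by rw [hspan]; trivial
    obtain ⟨c, hc⟩ := (Submodule.mem_span_range_iff_exists_fun R).mp hbspan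
    have hb' : g (∑ i, algebraMap R B (c i) * α i) ∈ maximalIdeal V₀ := by
      have : (∑ i, algebraMap R B (c i) * α i) = b := by
        rw [← hc]
        exact Finset.sum_congr rfl fun i _ => by rw [Algebra.smul_def]
      rw [this]
      exact hb
    rw [← hc]
    refine Ideal.sum_mem _ fun i _ => ?_
    rw [Algebra.smul_def]
    exact Ideal.mul_mem_right _ _ (Ideal.mem_map_of_mem _ (hind c hb' i))
  · rw [Ideal.map_le_iff_le_comap]
    intro r hr
    exact (hdom r).mpr hr

include hdom hspan hind in
/-- **`B` is local**, with maximal ideal `g⁻¹(𝔪_{V₀})`: `B` is integral over `R`, so every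
maximal ideal of `B` lies over `𝔪_R` and contains `𝔪_R B = g⁻¹(𝔪_{V₀})`, which is itself
maximal (a prime lying over the maximal ideal `𝔪_R`). [folklore] -/
theorem isLocalRing_of_comap_maximalIdeal [Nontrivial B] : IsLocalRing B := by
  classical
  haveI : Module.Finite R B := ⟨⟨Finset.univ.image α, by
    rw [Finset.coe_image, Finset.coe_univ, Set.image_univ, hspan]⟩⟩
  haveI : Algebra.IsIntegral R B := inferInstance
  set P := (maximalIdeal V₀).comap g with hP
  haveI hPprime : P.IsPrime := Ideal.comap_isPrime g _
  have hPcomap : P.comap (algebraMap R B) = maximalIdeal R := by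
    ext r
    rw [Ideal.mem_comap, hP, Ideal.mem_comap]
    exact hdom r
  have hPmax : P.IsMaximal :=
    Ideal.isMaximal_of_isIntegral_of_isMaximal_comap P (by rw [hPcomap]; infer_instance)
  refine IsLocalRing.of_unique_max_ideal ⟨P, hPmax, fun Q hQ => ?_⟩
  -- `Q ⊇ 𝔪_R B = P`
  have hQcomap : (Q.comap (algebraMap R B)).IsMaximal :=
    Ideal.isMaximal_comap_of_isIntegral_of_isMaximal Q
  have hQc : Q.comap (algebraMap R B) = maximalIdeal R := IsLocalRing.eq_maximalIdeal hQcomap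
  have hPQ : P ≤ Q := by
    rw [hP, comap_maximalIdeal_eq_map g hdom α hspan hind, Ideal.map_le_iff_le_comap, hQc]
  exact (hPmax.eq_of_le hQ.ne_top hPQ).symm

include hdom hspan hind in
/-- The maximal ideal of the local ring `B` is `g⁻¹(𝔪_{V₀}) = 𝔪_R B`. [folklore] -/
theorem maximalIdeal_eq_comap_maximalIdeal [Nontrivial B] :
    (letI := isLocalRing_of_comap_maximalIdeal g hdom α hspan hind; maximalIdeal B) =
      (maximalIdeal V₀).comap g := by
  classical
  letI := isLocalRing_of_comap_maximalIdeal g hdom α hspan hind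
  haveI : Module.Finite R B := ⟨⟨Finset.univ.image α, by
    rw [Finset.coe_image, Finset.coe_univ, Set.image_univ, hspan]⟩⟩
  haveI : Algebra.IsIntegral R B := inferInstance
  haveI hPprime : ((maximalIdeal V₀).comap g).IsPrime := Ideal.comap_isPrime g _
  have hPcomap : ((maximalIdeal V₀).comap g).comap (algebraMap R B) = maximalIdeal R := by
    ext r
    rw [Ideal.mem_comap, Ideal.mem_comap]
    exact hdom r
  have hPmax : ((maximalIdeal V₀).comap g).IsMaximal :=
    Ideal.isMaximal_of_isIntegral_of_isMaximal_comap _ (by rw [hPcomap]; infer_instance)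
  exact (IsLocalRing.eq_maximalIdeal hPmax).symm

include hdom hspan hind in
/-- In the local ring `B`, `g` is a local homomorphism: `g b ∈ 𝔪_{V₀} ↔ b ∈ 𝔪_B`. [folklore] -/
theorem isLocalHom_of_comap_maximalIdeal [Nontrivial B] :
    letI := isLocalRing_of_comap_maximalIdeal g hdom α hspan hind
    IsLocalHom g := by
  letI := isLocalRing_of_comap_maximalIdeal g hdom α hspan hind
  refine ⟨fun b hb => ?_⟩
  by_contra hnu
  have hbm : b ∈ maximalIdeal B := (IsLocalRing.mem_maximalIdeal b).mpr hnu
  rw [maximalIdeal_eq_comap_maximalIdeal g hdom α hspan hind, Ideal.mem_comap] at hbm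
  exact (IsLocalRing.mem_maximalIdeal _).mp hbm hb

include hdom hspan hind in
/-- **A residually free finite extension of a regular local ring is regular.** With `R`
regular local, `R → B` injective, `B = ∑ R αᵢ`, and `g : B → V₀` into a local ring
dominating `R` and valuation-independent on the `αᵢ` modulo `𝔪_R`: `B` is local
(`isLocalRing_of_comap_maximalIdeal`), Noetherian (finite over `R`), of dimension `dim R`
(integral injective extension), and its maximal ideal `𝔪_R B` is generated by `dim R`
elements; so `B` is a regular local ring. [folklore] -/
theorem isRegularLocalRing_of_comap_maximalIdeal (hR : IsRegularLocalRing R) [Nontrivial B]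
    (hinj : Function.Injective (algebraMap R B)) : IsRegularLocalRing B := by
  classical
  haveI : IsRegularLocalRing R := hR
  haveI : IsNoetherianRing R := inferInstance
  letI hloc := isLocalRing_of_comap_maximalIdeal g hdom α hspan hind
  haveI : Module.Finite R B := ⟨⟨Finset.univ.image α, by
    rw [Finset.coe_image, Finset.coe_univ, Set.image_univ, hspan]⟩⟩
  haveI : Algebra.IsIntegral R B := inferInstance
  haveI : IsNoetherianRing B := by
    have h : IsNoetherian R B := isNoetherian_of_isNoetherianRing_of_finite R B
    exact isNoetherian_of_tower R h
  have hmax : maximalIdeal B = (maximalIdeal R).map (algebraMap R B) := by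
    rw [← comap_maximalIdeal_eq_map g hdom α hspan hind]
    exact maximalIdeal_eq_comap_maximalIdeal g hdom α hspan hind
  have hle : (maximalIdeal B).spanFinrank ≤ (maximalIdeal R).spanFinrank := by
    rw [hmax]
    exact Ideal.spanFinrank_map_le_of_fg (algebraMap R B)
      (maximalIdeal R).fg_of_isNoetherianRing
  have hdim : ringKrullDim B = ringKrullDim R := ringKrullDim_eq_of_isIntegral hinj
  refine IsRegularLocalRing.of_spanFinrank_maximalIdeal_le B ?_
  calc ((maximalIdeal B).spanFinrank : WithBot ℕ∞)
      ≤ (maximalIdeal R).spanFinrank := by exact_mod_cast hle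
    _ = ringKrullDim R := IsRegularLocalRing.spanFinrank_maximalIdeal
    _ = ringKrullDim B := hdim.symm

end Regular

end Literature.AlgebraicGeometry.Resolution

end
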